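import Summits.CriticalPhenomena.PercolationContinuityZ3.Theorems.PercAnnulusCrossingIICPairFormula
import Summits.CriticalPhenomena.PercolationContinuityZ3.Theorems.PercAnnulusCrossingIICOneArmBallSum
import Summits.CriticalPhenomena.PercolationContinuityZ3.Theorems.PercAnnulusCrossingIICTwoPointSandwich
import HarnessLib

/-!
# Volume homogeneity of Kesten's IIC: around each of its sites the IIC has the mean volume growth of the root (lane RSW3, p1 gen 21)

builds on p205010 (kernel theorem, internal audit signed; external expert review pending) — USED through `θ(p_c) = 0`
(exact re-rooting, inside `…IICPairFormula`).

RSW3 lane (LANE 3 `prim-rsw3`), seat `prim-rsw3-p1` (gen 21).  Helper file (`--supports stmt-CriticalPhenomena-4575`);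
no definitions, no sorries.  Memo `run/shared/lean/prim/rsw3/P1-QM.md` §34.

Summing the pair formula `ν(x, y ∈ C(0)) ≍ π(min(‖x‖,‖y‖))·π(‖x − y‖)` (`…IICPairFormula`) over the ball `y ∈ x + Λ(r)`, with the one-arm
ball sum `Σ_{w ∈ Λ(n)} π(‖w‖) ≤ Cn^dπ(n)` and the half-count of `…IICOneArmBallSum`:

* `setIntegral_card_filter_openConn_translate_eq_sum` — the ball volume about `x` as a sum of indicators;
* **`exists_iicMeasure_sum_box_pair_two_sided_criticalProbI`** — VOLUME HOMOGENEITY: there are `n₀` and `0 < c, C` with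
  **`c·r^d π_{p_c}(r)·π_{p_c}(‖x‖) ≤ Σ_{w ∈ Λ(r)} ν({0 ↔ x} ∩ {0 ↔ x + w}) ≤ C·r^d π_{p_c}(r)·π_{p_c}(‖x‖)`** for every IIC probability
  measure `ν`, every `‖x‖ ≥ n₀` and every `r ≥ n₀`;
* **`exists_iicMeasure_setIntegral_ballVolume_two_sided_criticalProbI`** — the same as **`c·r^dπ(r)·ν(0 ↔ x) ≤ ∫_{0 ↔ x} |C(0) ∩ (x+Λ(r))| dν
  ≤ C·r^dπ(r)·ν(0 ↔ x)`**: CONDITIONALLY ON CONTAINING `x`, THE IIC HAS `≍ r^dπ(r) ≍ E_ν|C(0) ∩ Λ(r)|` SITES WITHIN DISTANCE `r` OF `x`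
  (gen 18 / p2 gen 20: `E_ν|C(0) ∩ Λ(r)| ≍ r^dπ(r)`), UNIFORMLY in the position of `x` relative to `r` — around the root (`r ≫ ‖x‖`), at the
  scale of the root (`r ≍ ‖x‖`, the new regime) and far from it (`r ≪ ‖x‖`): the IIC has the same mean volume growth around every one of
  its sites as around the root.
All at `p_c(ℤ^d)`, `d ≥ 2`, under (A2)□(s,L) + `CU⁺_l` + UAD.
References: H. Kesten, Probab. Theory Relat. Fields 73 (1986) Thm. (8); D. Basu, A. Sapozhnikov, ECP 22 (2017) Thm. 1.1, Remark 2.1.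
-/

noncomputable section

namespace Summit.CriticalPhenomena.PercolationContinuityZ3.Theorems.Crossing

open MeasureTheory Filter Topology Literature.Probability.Percolation Literature.Probability.LatticeModels
open Literature.Probability.Percolation.DCT16
open Summit.CriticalPhenomena.PercolationContinuityZ3.Theorems.SurfaceTension

variable {d : ℕ}

/-! ## §3 Volume homogeneity -/

open Classical in
/-- **`∫_H #{y ∈ x + Λ(r) : 0 ↔ y} dν = Σ_{w ∈ Λ(r)} ν(H ∩ {0 ↔ x + w})`** for a finite measure `ν` and any event `H` (the ball volume about `x`
as a sum of indicators). [folklore] -/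
theorem setIntegral_card_filter_openConn_translate_eq_sum (ν : Measure (BondConfig (Site d))) [IsFiniteMeasure ν]
    (H : Set (BondConfig (Site d))) (x : Site d) (r : ℕ) :
    ∫ ω in H, (((((box d r).image fun w => x + w).filter fun y =>
        ω ∈ (openConn (0 : Site d) y : Set (BondConfig (Site d)))).card : ℕ) : ℝ) ∂ν =
      ∑ w ∈ box d r, ν.real (H ∩ (openConn (0 : Site d) (x + w) : Set (BondConfig (Site d)))) := by
  have hpt : ∀ ω : BondConfig (Site d), (((((box d r).image fun w => x + w).filter fun y =>
      ω ∈ (openConn (0 : Site d) y : Set (BondConfig (Site d)))).card : ℕ) : ℝ) =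
      ∑ y ∈ (box d r).image (fun w => x + w), (openConn (0 : Site d) y : Set (BondConfig (Site d))).indicator (1 : BondConfig (Site d) → ℝ) ω := by
    intro ω
    rw [Finset.card_filter]; push_cast
    refine Finset.sum_congr rfl fun y _ => ?_
    by_cases h : ω ∈ (openConn (0 : Site d) y : Set (BondConfig (Site d))) <;> simp [h]
  have hind : ∀ y : Site d, Integrable ((openConn (0 : Site d) y : Set (BondConfig (Site d))).indicator (1 : BondConfig (Site d) → ℝ)) (ν.restrict H) :=
    fun y => (integrable_const (1 : ℝ)).indicator (measurableSet_openConn_holds 0 y)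
  simp_rw [hpt]
  rw [integral_finsetSum _ fun y _ => hind y, Finset.sum_image fun w _ w' _ h => add_left_cancel h]
  refine Finset.sum_congr rfl fun w _ => ?_
  rw [integral_indicator_one (measurableSet_openConn_holds 0 (x + w)), measureReal_restrict_apply (measurableSet_openConn_holds 0 (x + w)),
    Set.inter_comm]

open Classical in
/-- **VOLUME HOMOGENEITY OF KESTEN'S IIC** (`p_c(ℤ^d)`, `d ≥ 2`; (A2)□ at aspect `(s,L)`, `2 ≤ s ≤ L`, `ϰ > 0`; `CU⁺_l(c_U)`, `l ≥ 2`,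
`c_U > 0`; UAD; `θ(p_c) = 0` from p205010 via the pair formula): there are `n₀ ≥ 1` and `0 < c, C` such that for every IIC probability
measure `ν`, every site `x` with `‖x‖_∞ ≥ n₀` and every radius `r ≥ n₀`:
**`c·r^d π_{p_c}(r)·π_{p_c}(‖x‖) ≤ Σ_{w ∈ Λ(r)} ν({0 ↔ x} ∩ {0 ↔ x + w}) ≤ C·r^d π_{p_c}(r)·π_{p_c}(‖x‖)`** — the mean number of sites of
the IIC within distance `r` of `x`, on the event that `x` belongs to the IIC, is `≍ r^dπ(r)·ν(0 ↔ x)`, UNIFORMLY in the position of `x`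
relative to `r` (with `E_ν|C(0) ∩ Λ(r)| ≍ r^dπ(r)`, gen 18 / p2 gen 20: the IIC has the same mean volume growth around every one of its
sites as around the root).  Lower: the pair formula on the `≥ r^d/2` sites `w` with `n₀ ≤ ‖w‖ ≤ r`, `‖x + w‖ ≥ ‖x‖`
(`pow_le_two_mul_card_filter`), each `≥ cπ(‖x‖)π(r)`.  Upper: every term is `≤ Kπ(‖x‖)(π(‖w‖) + π(‖x + w‖))` (pair formula, ratio bound in
the three regimes `‖x+w‖ ≥ ‖x‖`, `‖x‖/8 ≤ ‖x+w‖ < ‖x‖`, `‖x+w‖ < ‖x‖/8`; two-point bound for the small sites), and both one-arm sums over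
the ball are `≤ C'r^dπ(r)` (`sum_box_oneArmProb_supNorm_le_criticalProbI`; for `Σ π(‖x+w‖)`: `x + Λ(r) ⊆ Λ(3r)` if `‖x‖ < 2r`, else every
term is `≤ π(‖x‖ − r) ≤ Bπ(‖x‖) ≤ Bπ(r)`). [cite: Kesten1986, Thm. (8)] [cite: BasuSapozhnikov2017ECP, Thm. 1.1 and Remark 2.1] -/
theorem exists_iicMeasure_sum_box_pair_two_sided_criticalProbI (hd : 2 ≤ d) {s L : ℕ} (hs : 2 ≤ s) (hsL : s ≤ L)
    {ϰ : ℝ} (hϰ : 0 < ϰ) (hA2 : SetToSetQuasiMultAspectAt d (criticalProbI d) s L ϰ) {l : ℕ} (hl : 2 ≤ l) {cU : ℝ} (hcU : 0 < cU)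
    (hCU : ∀ a : ℕ, 1 ≤ a → ∀ E : Set (BondConfig (Site d)), IsUpperSet E → MeasurableSet E →
      cU * (bondPercolation (zdGraph d) (criticalProbI d)).real E ≤ (bondPercolation (zdGraph d) (criticalProbI d)).real (E ∩
        {ω : BondConfig (Site d) | ∀ t ∈ innerBoundary (zdGraph d) (box d a), ∀ s ∈ innerBoundary (zdGraph d) (box d (l * a)),
          ∀ t' ∈ innerBoundary (zdGraph d) (box d a), ∀ s' ∈ innerBoundary (zdGraph d) (box d (l * a)),
          ω ∈ openConnIn (↑((box d (l * a) \ box d a) ∪ innerBoundary (zdGraph d) (box d a)) : Set (Site d)) t s →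
          ω ∈ openConnIn (↑((box d (l * a) \ box d a) ∪ innerBoundary (zdGraph d) (box d a)) : Set (Site d)) t' s' →
          ω ∈ openConnIn (↑((box d (l * a) \ box d a) ∪ innerBoundary (zdGraph d) (box d a)) : Set (Site d)) s s'}))
    (hUAD : ∀ ε : ℝ, 0 < ε → ∃ K₀ : ℕ, ∀ m : ℕ, 1 ≤ m → ∀ N : ℕ, K₀ * m ≤ N →
      (bondPercolation (zdGraph d) (criticalProbI d)).real (boxCrossing d m N) ≤ ε) :
    ∃ (n₀ : ℕ) (c C : ℝ), 1 ≤ n₀ ∧ 0 < c ∧ 0 < C ∧ ∀ (ν : Measure (BondConfig (Site d))) [IsProbabilityMeasure ν],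
      (∀ (F : Finset (Sym2 (Site d))) (E : Set (BondConfig (Site d))), MeasurableSet E → DeterminedBy E ↑F →
        Tendsto (fun n : ℕ => (bondPercolation (zdGraph d) (criticalProbI d)).real (E ∩ siteToBoundary d n) /
          oneArmProb d (criticalProbI d) n) atTop (𝓝 (ν.real E))) →
      ∀ x : Site d, n₀ ≤ Site.supNorm x → ∀ r : ℕ, n₀ ≤ r →
        c * ((r : ℝ) ^ d * oneArmProb d (criticalProbI d) r) * oneArmProb d (criticalProbI d) (Site.supNorm x) ≤
            ∑ w ∈ box d r, ν.real ((openConn (0 : Site d) x : Set (BondConfig (Site d))) ∩ openConn (0 : Site d) (x + w)) ∧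
          ∑ w ∈ box d r, ν.real ((openConn (0 : Site d) x : Set (BondConfig (Site d))) ∩ openConn (0 : Site d) (x + w)) ≤
            C * ((r : ℝ) ^ d * oneArmProb d (criticalProbI d) r) * oneArmProb d (criticalProbI d) (Site.supNorm x) := by
  have hd1 : 1 ≤ d := le_trans (by norm_num) hd
  have hp : 0 < ((criticalProbI d : unitInterval) : ℝ) := by
    rw [coe_criticalProbI]; exact criticalProb_zd_pos d hd1
  have hπ : ∀ m : ℕ, 0 < oneArmProb d (criticalProbI d) m := fun m => oneArmProb_pos hd1 _ hp m
  obtain ⟨nA, cA, CA, hnA, hcA, hCA, hA⟩ := exists_iicMeasure_real_pair_two_sided_criticalProbI hd hs hsL hϰ hA2 hl hcU hCU hUAD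
  obtain ⟨n₂, c₂, C₂, hn₂, hc₂, hC₂, h2⟩ := exists_iicMeasure_real_openConn_two_sided_criticalProbI hd hs hsL hϰ hA2 hl hcU hCU hUAD
  obtain ⟨c, hc, hQM⟩ := oneArmQuasiMultAt_of_setToSetQuasiMultAspectAt hd hs hsL hϰ hA2
  obtain ⟨B, hB, hR⟩ := Rsw3.exists_oneArmProb_ratio_of_setToSetQuasiMultAspectAt hd hs hsL hϰ hA2
  obtain ⟨Cs, hCs, hsum⟩ := sum_box_oneArmProb_supNorm_le_criticalProbI hd hc hQM
  have hB1 : 1 ≤ B := by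
    have h := hR 1 1 le_rfl le_rfl (by norm_num)
    have h1 := hπ 1
    by_contra hlt
    have h3 : B * oneArmProb d (criticalProbI d) 1 < 1 * oneArmProb d (criticalProbI d) 1 :=
      mul_lt_mul_of_pos_right (lt_of_not_ge hlt) h1
    linarith
  have hπA := hπ nA
  -- the per-term constant of the upper bound
  obtain ⟨K, hK⟩ : ∃ K : ℝ, K = max (C₂ / oneArmProb d (criticalProbI d) nA) (CA * B) := ⟨_, rfl⟩
  have hK0 : 0 < K := by rw [hK]; exact lt_max_of_lt_left (div_pos hC₂ hπA)
  have hK1 : C₂ / oneArmProb d (criticalProbI d) nA ≤ K := by rw [hK]; exact le_max_left _ _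
  have hK2 : CA * B ≤ K := by rw [hK]; exact le_max_right _ _
  have hK3 : CA ≤ K := le_trans (le_mul_of_one_le_right hCA.le hB1) hK2
  refine ⟨max (8 * nA) n₂, cA / 2, K * (Cs + (B + Cs) * (3 : ℝ) ^ d), le_trans (by omega) (le_max_left _ _), by positivity,
    by positivity, fun ν _ hν x hx r hr => ?_⟩
  have hxA : nA ≤ Site.supNorm x := le_trans (by omega) (le_trans (le_max_left _ _) hx)
  have hx8 : 8 * nA ≤ Site.supNorm x := le_trans (le_max_left _ _) hx
  have hx2 : n₂ ≤ Site.supNorm x := le_trans (le_max_right _ _) hx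
  have hrA : 2 * nA ≤ r := le_trans (by omega) (le_trans (le_max_left _ _) hr)
  have hr1 : 1 ≤ r := le_trans (by omega) hrA
  have hπa := hπ (Site.supNorm x)
  have hπr := hπ r
  have hrd : 0 ≤ (r : ℝ) ^ d * oneArmProb d (criticalProbI d) r := mul_nonneg (pow_nonneg (Nat.cast_nonneg r) d) hπr.le
  have hsubw : ∀ w : Site d, x - (x + w) = -w := fun w => by abel
  have hνnn : ∀ w : Site d, 0 ≤ ν.real ((openConn (0 : Site d) x : Set (BondConfig (Site d))) ∩ openConn (0 : Site d) (x + w)) :=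
    fun w => measureReal_nonneg
  constructor
  · -- LOWER BOUND
    set G := (box d r).filter fun w => nA ≤ Site.supNorm w ∧ Site.supNorm x ≤ Site.supNorm (x + w) with hG
    have hcount : (r : ℝ) ^ d ≤ 2 * (G.card : ℝ) := pow_le_two_mul_card_filter hd1 x hnA hrA
    have hterm : ∀ w ∈ G, cA * oneArmProb d (criticalProbI d) (Site.supNorm x) * oneArmProb d (criticalProbI d) r ≤
        ν.real ((openConn (0 : Site d) x : Set (BondConfig (Site d))) ∩ openConn (0 : Site d) (x + w)) := by
      intro w hw
      rw [hG, Finset.mem_filter] at hw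
      obtain ⟨hwr, hwA, hxw⟩ := hw
      have h := (hA ν hν x (x + w) hxA (hxA.trans hxw) (by rw [hsubw, Site.supNorm_neg]; exact hwA)).1
      rw [min_eq_left hxw, hsubw, Site.supNorm_neg] at h
      have hmono : oneArmProb d (criticalProbI d) r ≤ oneArmProb d (criticalProbI d) (Site.supNorm w) :=
        real_siteToBoundary_antitone _ (mem_box_iff_supNorm_le.1 hwr)
      exact le_trans (mul_le_mul_of_nonneg_left hmono (mul_nonneg hcA.le hπa.le)) h
    have hGsub : G ⊆ box d r := Finset.filter_subset _ _
    calc cA / 2 * ((r : ℝ) ^ d * oneArmProb d (criticalProbI d) r) * oneArmProb d (criticalProbI d) (Site.supNorm x)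
        ≤ cA / 2 * ((2 * (G.card : ℝ)) * oneArmProb d (criticalProbI d) r) * oneArmProb d (criticalProbI d) (Site.supNorm x) :=
          mul_le_mul_of_nonneg_right (mul_le_mul_of_nonneg_left (mul_le_mul_of_nonneg_right hcount hπr.le) (by positivity)) hπa.le
      _ = ∑ _w ∈ G, cA * oneArmProb d (criticalProbI d) (Site.supNorm x) * oneArmProb d (criticalProbI d) r := by
          rw [Finset.sum_const, nsmul_eq_mul]; ring
      _ ≤ ∑ w ∈ G, ν.real ((openConn (0 : Site d) x : Set (BondConfig (Site d))) ∩ openConn (0 : Site d) (x + w)) :=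
          Finset.sum_le_sum hterm
      _ ≤ _ := Finset.sum_le_sum_of_subset_of_nonneg hGsub fun w _ _ => hνnn w
  · -- UPPER BOUND: the per-term estimate
    have hνx : ν.real (openConn (0 : Site d) x) ≤ C₂ * oneArmProb d (criticalProbI d) (Site.supNorm x) :=
      (h2 ν hν (Site.supNorm x) x hx2 (self_mem_sphere x)).2
    have hterm : ∀ w : Site d, ν.real ((openConn (0 : Site d) x : Set (BondConfig (Site d))) ∩ openConn (0 : Site d) (x + w)) ≤
        K * oneArmProb d (criticalProbI d) (Site.supNorm x) *
          (oneArmProb d (criticalProbI d) (Site.supNorm w) + oneArmProb d (criticalProbI d) (Site.supNorm (x + w))) := by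
      intro w
      have hπw := hπ (Site.supNorm w)
      have hπy := hπ (Site.supNorm (x + w))
      have hT0 : ν.real ((openConn (0 : Site d) x : Set (BondConfig (Site d))) ∩ openConn (0 : Site d) (x + w)) ≤
          C₂ * oneArmProb d (criticalProbI d) (Site.supNorm x) :=
        (measureReal_mono Set.inter_subset_left (measure_ne_top _ _)).trans hνx
      -- the two target shapes
      have shapeW : ∀ M : ℝ, M ≤ K →
          M * oneArmProb d (criticalProbI d) (Site.supNorm x) * oneArmProb d (criticalProbI d) (Site.supNorm w) ≤
            K * oneArmProb d (criticalProbI d) (Site.supNorm x) *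
              (oneArmProb d (criticalProbI d) (Site.supNorm w) + oneArmProb d (criticalProbI d) (Site.supNorm (x + w))) :=
        fun M hM => mul_le_mul (mul_le_mul_of_nonneg_right hM hπa.le) (le_add_of_nonneg_right hπy.le) hπw.le
          (mul_nonneg hK0.le hπa.le)
      have shapeY : ∀ M : ℝ, M ≤ K →
          M * oneArmProb d (criticalProbI d) (Site.supNorm x) * oneArmProb d (criticalProbI d) (Site.supNorm (x + w)) ≤
            K * oneArmProb d (criticalProbI d) (Site.supNorm x) *
              (oneArmProb d (criticalProbI d) (Site.supNorm w) + oneArmProb d (criticalProbI d) (Site.supNorm (x + w))) :=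
        fun M hM => mul_le_mul (mul_le_mul_of_nonneg_right hM hπa.le) (le_add_of_nonneg_left hπw.le) hπy.le
          (mul_nonneg hK0.le hπa.le)
      by_cases hw : nA ≤ Site.supNorm w
      · by_cases hy : nA ≤ Site.supNorm (x + w)
        · have h := (hA ν hν x (x + w) hxA hy (by rw [hsubw, Site.supNorm_neg]; exact hw)).2
          rw [hsubw, Site.supNorm_neg] at h
          by_cases hxw : Site.supNorm x ≤ Site.supNorm (x + w)
          · rw [min_eq_left hxw] at h
            exact h.trans (shapeW CA hK3)
          · rw [min_eq_right (le_of_not_ge hxw)] at h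
            by_cases h8 : Site.supNorm x ≤ 8 * Site.supNorm (x + w)
            · have hratio : oneArmProb d (criticalProbI d) (Site.supNorm (x + w)) ≤ B * oneArmProb d (criticalProbI d) (Site.supNorm x) :=
                hR _ _ (le_trans hnA hy) (le_of_not_ge hxw) h8
              calc _ ≤ CA * oneArmProb d (criticalProbI d) (Site.supNorm (x + w)) * oneArmProb d (criticalProbI d) (Site.supNorm w) := h
                _ ≤ CA * (B * oneArmProb d (criticalProbI d) (Site.supNorm x)) * oneArmProb d (criticalProbI d) (Site.supNorm w) :=
                    mul_le_mul_of_nonneg_right (mul_le_mul_of_nonneg_left hratio hCA.le) hπw.le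
                _ = CA * B * oneArmProb d (criticalProbI d) (Site.supNorm x) * oneArmProb d (criticalProbI d) (Site.supNorm w) := by ring
                _ ≤ _ := shapeW (CA * B) hK2
            · -- `‖x + w‖ < ‖x‖/8`: then `‖x‖ ≤ ‖x+w‖ + ‖w‖` forces `‖x‖ ≤ 8‖w‖`, so `π(‖w‖) ≤ Bπ(‖x‖)`
              have htri : Site.supNorm x ≤ Site.supNorm (x + w) + Site.supNorm w := by
                have h' := Site.supNorm_le_supNorm_sub_add x (-w)
                rwa [sub_neg_eq_add, Site.supNorm_neg] at h'
              have hratio : oneArmProb d (criticalProbI d) (Site.supNorm w) ≤ B * oneArmProb d (criticalProbI d) (Site.supNorm x) := by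
                rcases le_or_gt (Site.supNorm x) (Site.supNorm w) with h1 | h1
                · calc oneArmProb d (criticalProbI d) (Site.supNorm w) ≤ oneArmProb d (criticalProbI d) (Site.supNorm x) :=
                        real_siteToBoundary_antitone _ h1
                    _ = 1 * oneArmProb d (criticalProbI d) (Site.supNorm x) := (one_mul _).symm
                    _ ≤ B * oneArmProb d (criticalProbI d) (Site.supNorm x) := mul_le_mul_of_nonneg_right hB1 hπa.le
                · exact hR _ _ (le_trans hnA hw) h1.le (by omega)
              calc _ ≤ CA * oneArmProb d (criticalProbI d) (Site.supNorm (x + w)) * oneArmProb d (criticalProbI d) (Site.supNorm w) := h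
                _ ≤ CA * oneArmProb d (criticalProbI d) (Site.supNorm (x + w)) * (B * oneArmProb d (criticalProbI d) (Site.supNorm x)) :=
                    mul_le_mul_of_nonneg_left hratio (mul_nonneg hCA.le hπy.le)
                _ = CA * B * oneArmProb d (criticalProbI d) (Site.supNorm x) * oneArmProb d (criticalProbI d) (Site.supNorm (x + w)) := by
                    ring
                _ ≤ _ := shapeY (CA * B) hK2
        · -- `‖x + w‖ < nA`: `ν ≤ C₂π(‖x‖) ≤ (C₂/π(nA))·π(‖x‖)·π(‖x+w‖)`
          have hmono : oneArmProb d (criticalProbI d) nA ≤ oneArmProb d (criticalProbI d) (Site.supNorm (x + w)) :=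
            real_siteToBoundary_antitone _ (by omega)
          calc _ ≤ C₂ * oneArmProb d (criticalProbI d) (Site.supNorm x) := hT0
            _ = C₂ / oneArmProb d (criticalProbI d) nA * oneArmProb d (criticalProbI d) (Site.supNorm x) *
                  oneArmProb d (criticalProbI d) nA := by field_simp
            _ ≤ C₂ / oneArmProb d (criticalProbI d) nA * oneArmProb d (criticalProbI d) (Site.supNorm x) *
                  oneArmProb d (criticalProbI d) (Site.supNorm (x + w)) :=
                mul_le_mul_of_nonneg_left hmono (mul_nonneg (div_pos hC₂ hπA).le hπa.le)
            _ ≤ _ := shapeY _ hK1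
      · -- `‖w‖ < nA`
        have hmono : oneArmProb d (criticalProbI d) nA ≤ oneArmProb d (criticalProbI d) (Site.supNorm w) :=
          real_siteToBoundary_antitone _ (by omega)
        calc _ ≤ C₂ * oneArmProb d (criticalProbI d) (Site.supNorm x) := hT0
          _ = C₂ / oneArmProb d (criticalProbI d) nA * oneArmProb d (criticalProbI d) (Site.supNorm x) *
                oneArmProb d (criticalProbI d) nA := by field_simp
          _ ≤ C₂ / oneArmProb d (criticalProbI d) nA * oneArmProb d (criticalProbI d) (Site.supNorm x) *
                oneArmProb d (criticalProbI d) (Site.supNorm w) :=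
              mul_le_mul_of_nonneg_left hmono (mul_nonneg (div_pos hC₂ hπA).le hπa.le)
          _ ≤ _ := shapeW _ hK1
    -- the two one-arm sums over the ball
    have hS1 : ∑ w ∈ box d r, oneArmProb d (criticalProbI d) (Site.supNorm w) ≤ Cs * ((r : ℝ) ^ d * oneArmProb d (criticalProbI d) r) := by
      rw [← mul_assoc]; exact hsum r hr1
    have h3r : (2 * (r : ℝ) + 1) ^ d ≤ (3 : ℝ) ^ d * (r : ℝ) ^ d := by
      rw [← mul_pow]
      exact pow_le_pow_left₀ (by positivity) (by
        have : (1 : ℝ) ≤ r := by exact_mod_cast hr1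
        linarith) d
    have hS2 : ∑ w ∈ box d r, oneArmProb d (criticalProbI d) (Site.supNorm (x + w)) ≤
        (B + Cs) * (3 : ℝ) ^ d * ((r : ℝ) ^ d * oneArmProb d (criticalProbI d) r) := by
      by_cases h2r : 2 * r ≤ Site.supNorm x
      · -- far site: every term is `≤ π(‖x‖ − r) ≤ Bπ(‖x‖) ≤ Bπ(r)`
        have hterm2 : ∀ w ∈ box d r, oneArmProb d (criticalProbI d) (Site.supNorm (x + w)) ≤ B * oneArmProb d (criticalProbI d) r := by
          intro w hw
          have hwr := mem_box_iff_supNorm_le.1 hw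
          have htri : Site.supNorm x ≤ Site.supNorm (x + w) + Site.supNorm w := by
            have h' := Site.supNorm_le_supNorm_sub_add x (-w)
            rwa [sub_neg_eq_add, Site.supNorm_neg] at h'
          have hge : Site.supNorm x - r ≤ Site.supNorm (x + w) := by omega
          calc oneArmProb d (criticalProbI d) (Site.supNorm (x + w)) ≤ oneArmProb d (criticalProbI d) (Site.supNorm x - r) :=
                real_siteToBoundary_antitone _ hge
            _ ≤ B * oneArmProb d (criticalProbI d) (Site.supNorm x) := hR _ _ (by omega) (by omega) (by omega)
            _ ≤ B * oneArmProb d (criticalProbI d) r :=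
                mul_le_mul_of_nonneg_left (real_siteToBoundary_antitone _ (by omega)) hB.le
        calc ∑ w ∈ box d r, oneArmProb d (criticalProbI d) (Site.supNorm (x + w))
            ≤ ∑ _w ∈ box d r, B * oneArmProb d (criticalProbI d) r := Finset.sum_le_sum hterm2
          _ = (2 * (r : ℝ) + 1) ^ d * (B * oneArmProb d (criticalProbI d) r) := by
              rw [Finset.sum_const, nsmul_eq_mul, card_box]; push_cast; ring
          _ ≤ (3 : ℝ) ^ d * (r : ℝ) ^ d * (B * oneArmProb d (criticalProbI d) r) :=
              mul_le_mul_of_nonneg_right h3r (mul_nonneg hB.le hπr.le)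
          _ = B * (3 : ℝ) ^ d * ((r : ℝ) ^ d * oneArmProb d (criticalProbI d) r) := by ring
          _ ≤ (B + Cs) * (3 : ℝ) ^ d * ((r : ℝ) ^ d * oneArmProb d (criticalProbI d) r) :=
              mul_le_mul_of_nonneg_right (mul_le_mul_of_nonneg_right (by linarith) (pow_nonneg (by norm_num) d)) hrd
      · -- near site: `x + Λ(r) ⊆ Λ(3r)`
        have h2r' : Site.supNorm x < 2 * r := lt_of_not_ge h2r
        have himage : ∑ w ∈ box d r, oneArmProb d (criticalProbI d) (Site.supNorm (x + w)) =
            ∑ y ∈ (box d r).image (fun w => x + w), oneArmProb d (criticalProbI d) (Site.supNorm y) := by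
          rw [Finset.sum_image fun w _ w' _ h => add_left_cancel h]
        have hsub3 : (box d r).image (fun w => x + w) ⊆ box d (3 * r) := by
          intro y hy
          obtain ⟨w, hw, rfl⟩ := Finset.mem_image.1 hy
          have h := RSW3.add_mem_box_add hw (mem_box_iff_supNorm_le.2 (le_refl (Site.supNorm x)))
          exact box_mono d (by omega) h
        have h3 := hsum (3 * r) (by omega)
        calc ∑ w ∈ box d r, oneArmProb d (criticalProbI d) (Site.supNorm (x + w))
            = ∑ y ∈ (box d r).image (fun w => x + w), oneArmProb d (criticalProbI d) (Site.supNorm y) := himage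
          _ ≤ ∑ y ∈ box d (3 * r), oneArmProb d (criticalProbI d) (Site.supNorm y) :=
              Finset.sum_le_sum_of_subset_of_nonneg hsub3 fun y _ _ => measureReal_nonneg
          _ ≤ Cs * ((3 * r : ℕ) : ℝ) ^ d * oneArmProb d (criticalProbI d) (3 * r) := h3
          _ ≤ Cs * ((3 : ℝ) ^ d * (r : ℝ) ^ d) * oneArmProb d (criticalProbI d) r := by
              refine mul_le_mul (le_of_eq (by push_cast; ring)) (real_siteToBoundary_antitone _ (by omega)) measureReal_nonneg
                (mul_nonneg hCs.le (mul_nonneg (pow_nonneg (by norm_num) d) (pow_nonneg (Nat.cast_nonneg r) d)))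
          _ = Cs * (3 : ℝ) ^ d * ((r : ℝ) ^ d * oneArmProb d (criticalProbI d) r) := by ring
          _ ≤ (B + Cs) * (3 : ℝ) ^ d * ((r : ℝ) ^ d * oneArmProb d (criticalProbI d) r) :=
              mul_le_mul_of_nonneg_right (mul_le_mul_of_nonneg_right (by linarith) (pow_nonneg (by norm_num) d)) hrd
    calc ∑ w ∈ box d r, ν.real ((openConn (0 : Site d) x : Set (BondConfig (Site d))) ∩ openConn (0 : Site d) (x + w))
        ≤ ∑ w ∈ box d r, K * oneArmProb d (criticalProbI d) (Site.supNorm x) *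
            (oneArmProb d (criticalProbI d) (Site.supNorm w) + oneArmProb d (criticalProbI d) (Site.supNorm (x + w))) :=
          Finset.sum_le_sum fun w _ => hterm w
      _ = K * oneArmProb d (criticalProbI d) (Site.supNorm x) *
            (∑ w ∈ box d r, oneArmProb d (criticalProbI d) (Site.supNorm w) +
              ∑ w ∈ box d r, oneArmProb d (criticalProbI d) (Site.supNorm (x + w))) := by
          rw [← Finset.mul_sum, Finset.sum_add_distrib]
      _ ≤ K * oneArmProb d (criticalProbI d) (Site.supNorm x) *
            (Cs * ((r : ℝ) ^ d * oneArmProb d (criticalProbI d) r) + (B + Cs) * (3 : ℝ) ^ d * ((r : ℝ) ^ d * oneArmProb d (criticalProbI d) r)) :=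
          mul_le_mul_of_nonneg_left (add_le_add hS1 hS2) (mul_nonneg hK0.le hπa.le)
      _ = K * (Cs + (B + Cs) * (3 : ℝ) ^ d) * ((r : ℝ) ^ d * oneArmProb d (criticalProbI d) r) *
            oneArmProb d (criticalProbI d) (Site.supNorm x) := by ring

open Classical in
/-- **CONDITIONALLY ON CONTAINING A FAR SITE `x`, THE IIC HAS `≍ r^dπ(r)` SITES WITHIN DISTANCE `r` OF `x`** (hypotheses of
`exists_iicMeasure_sum_box_pair_two_sided_criticalProbI`): there are `n₀ ≥ 1` and `0 < c, C` such that for every IIC probability measure `ν`,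
every `‖x‖_∞ ≥ n₀` and every `r ≥ n₀`:
**`c·r^d π_{p_c}(r)·ν(0 ↔ x) ≤ ∫_{0 ↔ x} #{y ∈ x + Λ(r) : 0 ↔ y} dν ≤ C·r^d π_{p_c}(r)·ν(0 ↔ x)`** — the conditional mean volume of the IIC in
the ball of radius `r` about `x`, given `x ∈ C(0)`, is `≍ r^dπ_{p_c}(r) ≍ E_ν|C(0) ∩ Λ(r)|`, uniformly in `x`.
[cite: Kesten1986, Thm. (8)] [cite: BasuSapozhnikov2017ECP, Thm. 1.1 and Remark 2.1] -/
theorem exists_iicMeasure_setIntegral_ballVolume_two_sided_criticalProbI (hd : 2 ≤ d) {s L : ℕ} (hs : 2 ≤ s) (hsL : s ≤ L)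
    {ϰ : ℝ} (hϰ : 0 < ϰ) (hA2 : SetToSetQuasiMultAspectAt d (criticalProbI d) s L ϰ) {l : ℕ} (hl : 2 ≤ l) {cU : ℝ} (hcU : 0 < cU)
    (hCU : ∀ a : ℕ, 1 ≤ a → ∀ E : Set (BondConfig (Site d)), IsUpperSet E → MeasurableSet E →
      cU * (bondPercolation (zdGraph d) (criticalProbI d)).real E ≤ (bondPercolation (zdGraph d) (criticalProbI d)).real (E ∩
        {ω : BondConfig (Site d) | ∀ t ∈ innerBoundary (zdGraph d) (box d a), ∀ s ∈ innerBoundary (zdGraph d) (box d (l * a)),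
          ∀ t' ∈ innerBoundary (zdGraph d) (box d a), ∀ s' ∈ innerBoundary (zdGraph d) (box d (l * a)),
          ω ∈ openConnIn (↑((box d (l * a) \ box d a) ∪ innerBoundary (zdGraph d) (box d a)) : Set (Site d)) t s →
          ω ∈ openConnIn (↑((box d (l * a) \ box d a) ∪ innerBoundary (zdGraph d) (box d a)) : Set (Site d)) t' s' →
          ω ∈ openConnIn (↑((box d (l * a) \ box d a) ∪ innerBoundary (zdGraph d) (box d a)) : Set (Site d)) s s'}))
    (hUAD : ∀ ε : ℝ, 0 < ε → ∃ K₀ : ℕ, ∀ m : ℕ, 1 ≤ m → ∀ N : ℕ, K₀ * m ≤ N →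
      (bondPercolation (zdGraph d) (criticalProbI d)).real (boxCrossing d m N) ≤ ε) :
    ∃ (n₀ : ℕ) (c C : ℝ), 1 ≤ n₀ ∧ 0 < c ∧ 0 < C ∧ ∀ (ν : Measure (BondConfig (Site d))) [IsProbabilityMeasure ν],
      (∀ (F : Finset (Sym2 (Site d))) (E : Set (BondConfig (Site d))), MeasurableSet E → DeterminedBy E ↑F →
        Tendsto (fun n : ℕ => (bondPercolation (zdGraph d) (criticalProbI d)).real (E ∩ siteToBoundary d n) /
          oneArmProb d (criticalProbI d) n) atTop (𝓝 (ν.real E))) →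
      ∀ x : Site d, n₀ ≤ Site.supNorm x → ∀ r : ℕ, n₀ ≤ r →
        c * ((r : ℝ) ^ d * oneArmProb d (criticalProbI d) r) * ν.real (openConn (0 : Site d) x) ≤
            ∫ ω in (openConn (0 : Site d) x : Set (BondConfig (Site d))),
              (((((box d r).image fun w => x + w).filter fun y =>
                ω ∈ (openConn (0 : Site d) y : Set (BondConfig (Site d)))).card : ℕ) : ℝ) ∂ν ∧
          ∫ ω in (openConn (0 : Site d) x : Set (BondConfig (Site d))),
              (((((box d r).image fun w => x + w).filter fun y =>
                ω ∈ (openConn (0 : Site d) y : Set (BondConfig (Site d)))).card : ℕ) : ℝ) ∂ν ≤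
            C * ((r : ℝ) ^ d * oneArmProb d (criticalProbI d) r) * ν.real (openConn (0 : Site d) x) := by
  have hd1 : 1 ≤ d := le_trans (by norm_num) hd
  have hp : 0 < ((criticalProbI d : unitInterval) : ℝ) := by
    rw [coe_criticalProbI]; exact criticalProb_zd_pos d hd1
  have hπ : ∀ m : ℕ, 0 < oneArmProb d (criticalProbI d) m := fun m => oneArmProb_pos hd1 _ hp m
  obtain ⟨n₁, c₁, C₁, hn₁, hc₁, hC₁, hV⟩ := exists_iicMeasure_sum_box_pair_two_sided_criticalProbI hd hs hsL hϰ hA2 hl hcU hCU hUAD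
  obtain ⟨n₂, c₂, C₂, hn₂, hc₂, hC₂, h2⟩ := exists_iicMeasure_real_openConn_two_sided_criticalProbI hd hs hsL hϰ hA2 hl hcU hCU hUAD
  refine ⟨max n₁ n₂, c₁ / C₂, C₁ / c₂, le_trans hn₁ (le_max_left _ _), by positivity, by positivity, fun ν _ hν x hx r hr => ?_⟩
  have hsum : ∫ ω in (openConn (0 : Site d) x : Set (BondConfig (Site d))),
      (((((box d r).image fun w => x + w).filter fun y => ω ∈ (openConn (0 : Site d) y : Set (BondConfig (Site d)))).card : ℕ) : ℝ) ∂ν =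
      ∑ w ∈ box d r, ν.real ((openConn (0 : Site d) x : Set (BondConfig (Site d))) ∩ openConn (0 : Site d) (x + w)) := by
    exact setIntegral_card_filter_openConn_translate_eq_sum ν _ x r
  rw [hsum]
  have h := hV ν hν x (le_trans (le_max_left _ _) hx) r (le_trans (le_max_left _ _) hr)
  have ht := h2 ν hν (Site.supNorm x) x (le_trans (le_max_right _ _) hx) (self_mem_sphere x)
  have hπr := hπ r
  have hrd : 0 ≤ (r : ℝ) ^ d * oneArmProb d (criticalProbI d) r := mul_nonneg (pow_nonneg (Nat.cast_nonneg r) d) hπr.le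
  have hνx : 0 ≤ ν.real (openConn (0 : Site d) x) := measureReal_nonneg
  constructor
  · calc c₁ / C₂ * ((r : ℝ) ^ d * oneArmProb d (criticalProbI d) r) * ν.real (openConn (0 : Site d) x)
        ≤ c₁ / C₂ * ((r : ℝ) ^ d * oneArmProb d (criticalProbI d) r) * (C₂ * oneArmProb d (criticalProbI d) (Site.supNorm x)) :=
          mul_le_mul_of_nonneg_left ht.2 (mul_nonneg (by positivity) hrd)
      _ = c₁ * ((r : ℝ) ^ d * oneArmProb d (criticalProbI d) r) * oneArmProb d (criticalProbI d) (Site.supNorm x) := by field_simp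
      _ ≤ _ := h.1
  · calc ∑ w ∈ box d r, ν.real ((openConn (0 : Site d) x : Set (BondConfig (Site d))) ∩ openConn (0 : Site d) (x + w))
        ≤ C₁ * ((r : ℝ) ^ d * oneArmProb d (criticalProbI d) r) * oneArmProb d (criticalProbI d) (Site.supNorm x) := h.2
      _ = C₁ / c₂ * ((r : ℝ) ^ d * oneArmProb d (criticalProbI d) r) * (c₂ * oneArmProb d (criticalProbI d) (Site.supNorm x)) := by
          field_simp
      _ ≤ C₁ / c₂ * ((r : ℝ) ^ d * oneArmProb d (criticalProbI d) r) * ν.real (openConn (0 : Site d) x) :=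
          mul_le_mul_of_nonneg_left ht.1 (mul_nonneg (by positivity) hrd)

end Summit.CriticalPhenomena.PercolationContinuityZ3.Theorems.Crossing

end
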